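import Literature.Topology.FourManifolds.BasinPair
import Literature.Topology.FourManifolds.BasinCone
import HarnessLib

/-!
# Pairs of basin settings: the level conjugation of a boundary map from the trajectories of
# `ξ_A` to the trajectories of `ξ_B`

Topic `Literature/Topology/FourManifolds`; second file of the TWO-FIELD endgame (E2) of the Morse
line for the Torelli criterion (`BasinPair.lean`: the data; one-field version: `BasinConj.lean`,
`BasinPsi.lean`, `BasinCone.lean`).  Everything here is **proved**.

For `P : BasinPair g ξA ξB` and a self-map `χ` of `∂W` carrying the traces of `ξ_A` to the traces
of `ξ_B`:
* `BasinPair.swap` — the pair with the roles of the two fields exchanged;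
* `BasinPair.transportAB χ w = push_B (χ (bret_A w))` — the transport of `χ` from the level `L`
  read along `ξ_A` to the level `L` read along `ξ_B`;
* `BasinPair.conj χ x` — **the level conjugation**: the point of level `g x` on the
  `ξ_B`-trajectory of `transportAB χ (top_A x)`, for `x` in the domain `A.dom`: level-preserving
  (`apply_conj`), with `top_B (conj χ x) = transportAB χ (top_A x)`, mapping `A.dom` into `B.dom`,
  inverted by the conjugation of a left inverse for the swapped pair (`conj_swap_conj`), smooth on
  `A.dom` (`contMDiffAt_conj`), and commuting with the scalings of the common chart ball at `p₀`
  (`conj_ofChart_smul`: both flows are radial there).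

## References

* J. Milnor, *Lectures on the h-cobordism theorem* (1965), Def. 3.1, Thm. 4.1, Lemma 4.7,
  proof of Thm. 5.4 Assertion 4 (PDF pp. 11, 22, 25, 29). [MilnorHCobordism1965]
* H. B. Griffiths, *Automorphisms of a 3-dimensional handlebody*, Abh. Math. Sem. Univ. Hamburg
  26 (1964), §§3–6. [GriffithsHB1964Handlebody]
-/

open scoped Manifold ContDiff Topology
open Set Function Filter Metric

noncomputable section

namespace Literature.Topology.FourManifolds

open Cobordism FourManifolds.Flow

universe u

variable {n : ℕ} {W : Type u} [TopologicalSpace W] [T2Space W] [SecondCountableTopology W]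
  [CompactSpace W] [ChartedSpace (EuclideanHalfSpace (n + 1)) W] [IsManifold (𝓡∂ (n + 1)) ∞ W]

namespace BasinPair

variable {g : W → ℝ} {ξA ξB : Π x : W, TangentSpace (𝓡∂ (n + 1)) x} (P : BasinPair g ξA ξB)

/-- **The swapped pair.** [folklore] -/
def swap : BasinPair g ξB ξA where
  A := P.B
  B := P.A
  p₀_eq := P.p₀_eq.symm
  a'_eq := P.a'_eq.symm
  φ_eq := P.φ_eq.symm
  r₀_eq := P.r₀_eq.symm

/-- The `A`-setting of the swapped pair. [folklore] -/
@[simp] theorem swap_A : P.swap.A = P.B := rfl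

/-- The `B`-setting of the swapped pair. [folklore] -/
@[simp] theorem swap_B : P.swap.B = P.A := rfl

/-- The two basins: `B.basin` unfolds with `p₀ = A.p₀`. [folklore] -/
theorem basin_B_eq : P.B.basin = unstableSet (𝓡∂ (n + 1)) ξB P.A.p₀ := by
  rw [BasinSetting.basin, P.p₀_eq]

/-- `g (A.p₀) = g (B.p₀)`. [folklore] -/
theorem apply_p₀_eq : g P.B.p₀ = g P.A.p₀ := by rw [P.p₀_eq]

/-- `ofChart` agrees for the two settings (same chart, same centre). [folklore] -/
theorem ofChart_eq : P.B.ofChart = P.A.ofChart := by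
  funext v; simp only [BasinSetting.ofChart_def, BasinSetting.u₀, P.φ_eq, P.p₀_eq]

/-- `toChart` agrees for the two settings. [folklore] -/
theorem toChart_eq : P.B.toChart = P.A.toChart := by
  funext x; simp only [BasinSetting.toChart_def, BasinSetting.u₀, P.φ_eq, P.p₀_eq]

variable [Nonempty (BoundaryManifold.boundaryData n W).carrier]

/-- **The transport from `L` along `ξ_A` to `L` along `ξ_B`** of a self-map `χ` of `∂W`:
`w ↦ push_B (χ (bret_A w))`. [cite: GriffithsHB1964Handlebody, §§3–6] -/
def transportAB (χ : (𝓡∂ (n + 1)).boundary W → (𝓡∂ (n + 1)).boundary W) (w : W) : W :=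
  P.B.push (χ (P.A.bret w) : W)

/-- Unfolding `transportAB`. [folklore] -/
theorem transportAB_def (χ : (𝓡∂ (n + 1)).boundary W → (𝓡∂ (n + 1)).boundary W) (w : W) :
    P.transportAB χ w = P.B.push (χ (P.A.bret w) : W) := rfl

/-- **The transport on the push of a boundary point**: `transportAB χ (push_A y) = push_B (χ y)`. [folklore] -/
theorem transportAB_push_coe (χ : (𝓡∂ (n + 1)).boundary W → (𝓡∂ (n + 1)).boundary W)
    (y : (𝓡∂ (n + 1)).boundary W) : P.transportAB χ (P.A.push (y : W)) = P.B.push (χ y : W) := by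
  rw [transportAB_def, P.A.bret_push_coe]

/-- The transport takes values on the level `L`. [folklore] -/
theorem apply_transportAB (χ : (𝓡∂ (n + 1)).boundary W → (𝓡∂ (n + 1)).boundary W) (w : W) :
    g (P.transportAB χ w) = P.A.L := by rw [transportAB_def, P.B.apply_push_coe, P.L_eq]

/-- **The transport by a map carrying the traces of `ξ_A` to the traces of `ξ_B` maps
`L ∩ basin_A` into `L ∩ basin_B`.** [cite: MilnorHCobordism1965, Def. 3.9 (PDF p. 16)] -/
theorem transportAB_mem_basin {χ : (𝓡∂ (n + 1)).boundary W → (𝓡∂ (n + 1)).boundary W}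
    (hχ : ∀ y, χ y ∈ P.B.traces ↔ y ∈ P.A.traces) {w : W} (hw : w ∈ P.A.basin) (hwL : g w = P.A.L) :
    P.transportAB χ w ∈ P.B.basin := by
  have hwb : w = P.A.push (P.A.bret w : W) := by
    rw [P.A.coe_bret (by rw [hwL]; exact P.A.one_sub_a'_lt_L.le), P.A.push_ret_of_apply_eq_L hwL]
  have h1 : (P.A.bret w : W) ∈ P.A.basin := by
    rw [BasinSetting.mem_basin_iff, P.A.coe_mem_unstableSet_iff, ← hwb]; exact hw
  have h2 : (χ (P.A.bret w) : W) ∈ P.B.basin := by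
    rw [BasinSetting.coe_mem_basin_iff] at h1 ⊢
    exact fun h => h1 ((hχ _).1 h)
  rw [transportAB_def, BasinSetting.mem_basin_iff, ← P.B.coe_mem_unstableSet_iff]
  exact h2

/-- **Transports of the pair and of the swapped pair compose**: `transportBA χ' (transportAB χ w)
= push_A ((χ' ∘ χ) (bret_A w))`, and so a left inverse undoes the transport on `L`. [folklore] -/
theorem transportBA_transportAB {χ χ' : (𝓡∂ (n + 1)).boundary W → (𝓡∂ (n + 1)).boundary W}
    (h : LeftInverse χ' χ) {w : W} (hw : g w = P.A.L) : P.swap.transportAB χ' (P.transportAB χ w) = w := by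
  rw [transportAB_def, transportAB_def, swap_A, swap_B, P.B.bret_push_coe, h,
    P.A.coe_bret (by rw [hw]; exact P.A.one_sub_a'_lt_L.le), P.A.push_ret_of_apply_eq_L hw]

/-- **The level conjugation from `ξ_A` to `ξ_B`**: `x ↦` the point of level `g x` on the
`ξ_B`-trajectory of the transport of the `ξ_A`-top of `x` (junk off `A.dom`).
[cite: GriffithsHB1964Handlebody, §§3–6] [cite: MilnorHCobordism1965, Thm. 4.1 (PDF p. 22)] -/
def conj (χ : (𝓡∂ (n + 1)).boundary W → (𝓡∂ (n + 1)).boundary W) (x : W) : W :=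
  levelProj P.B.θ g (g x) (P.transportAB χ (P.A.top x))

/-- Unfolding `conj`. [folklore] -/
theorem conj_def (χ : (𝓡∂ (n + 1)).boundary W → (𝓡∂ (n + 1)).boundary W) (x : W) :
    P.conj χ x = levelProj P.B.θ g (g x) (P.transportAB χ (P.A.top x)) := rfl

variable {P}
variable {χ χ' : (𝓡∂ (n + 1)).boundary W → (𝓡∂ (n + 1)).boundary W}

omit [Nonempty (BoundaryManifold.boundaryData n W).carrier] in
/-- The level of a point of `A.dom` lies in `(g B.p₀, B.hi)`. [folklore] -/
theorem apply_mem_Ioo_B {x : W} (hx : x ∈ P.A.dom) : g x ∈ Ioo (g P.B.p₀) P.B.hi := by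
  rw [P.apply_p₀_eq, P.hi_eq]; exact BasinSetting.apply_mem_Ioo_of_mem_dom hx

/-- The transported top of a point of `A.dom` lies in `basin_B` (and on `L`). [folklore] -/
theorem transportAB_top_mem_basin (hχ : ∀ y, χ y ∈ P.B.traces ↔ y ∈ P.A.traces) {x : W}
    (hx : x ∈ P.A.dom) : P.transportAB χ (P.A.top x) ∈ P.B.basin :=
  P.transportAB_mem_basin hχ hx.2.2 (BasinSetting.apply_top_of_mem_dom hx)

/-- The transported top lies on the level `B.L`. [folklore] -/
theorem apply_transportAB_top (χ : (𝓡∂ (n + 1)).boundary W → (𝓡∂ (n + 1)).boundary W) (x : W) :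
    g (P.transportAB χ (P.A.top x)) = P.B.L := by rw [P.apply_transportAB, P.L_eq]

/-- **The level conjugation preserves the levels.** [cite: GriffithsHB1964Handlebody, §§3–6] -/
theorem apply_conj (hχ : ∀ y, χ y ∈ P.B.traces ↔ y ∈ P.A.traces) {x : W} (hx : x ∈ P.A.dom) :
    g (P.conj χ x) = g x :=
  P.B.apply_levelProj_of_mem_basin (transportAB_top_mem_basin hχ hx) (apply_transportAB_top χ x) (apply_mem_Ioo_B hx)

/-- **The `ξ_B`-top of the conjugate is the transported `ξ_A`-top.** [folklore] -/
theorem top_conj {x : W} (hx : x ∈ P.A.dom) : P.B.top (P.conj χ x) = P.transportAB χ (P.A.top x) := by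
  have _ := hx
  exact P.B.top_levelProj (apply_transportAB_top χ x) _

/-- **The level conjugation maps `A.dom` into `B.dom`.** [folklore] -/
theorem conj_mem_dom (hχ : ∀ y, χ y ∈ P.B.traces ↔ y ∈ P.A.traces) {x : W} (hx : x ∈ P.A.dom) :
    P.conj χ x ∈ P.B.dom :=
  P.B.levelProj_mem_dom (transportAB_top_mem_basin hχ hx) (apply_transportAB_top χ x) (apply_mem_Ioo_B hx)

/-- **The conjugation of a left inverse, for the swapped pair, inverts the conjugation** (on
`A.dom`). [cite: GriffithsHB1964Handlebody, §§3–6] -/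
theorem conj_swap_conj (h : LeftInverse χ' χ) (hχ : ∀ y, χ y ∈ P.B.traces ↔ y ∈ P.A.traces)
    {x : W} (hx : x ∈ P.A.dom) : P.swap.conj χ' (P.conj χ x) = x := by
  rw [conj_def, swap_B, swap_A, top_conj hx, apply_conj hχ hx,
    P.transportBA_transportAB h (BasinSetting.apply_top_of_mem_dom hx)]
  exact P.A.levelProj_top_self hx.2.1 (BasinSetting.apply_mem_Ioo_of_mem_dom hx)

/-! #### Smoothness -/

/-- **The transport of a smooth `χ` is smooth at the points of depth (for `A`) `< a'`.** [folklore] -/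
theorem contMDiffAt_transportAB (hχs : ContMDiff (𝓡 n) (𝓡 n) ∞ χ) {w : W} (hw : P.A.depth w < P.A.S.a') :
    ContMDiffAt (𝓡∂ (n + 1)) (𝓡∂ (n + 1)) ∞ (P.transportAB χ) w := by
  have h1 : ContMDiffAt (𝓡∂ (n + 1)) (𝓡∂ (n + 1)) ∞ (fun z => ((χ (P.A.bret z) : (𝓡∂ (n + 1)).boundary W) : W)) w :=
    (BoundaryManifold.isSmoothEmbedding_subtype_val (n := n) (W := W)).contMDiff.contMDiffAt.comp w
      (hχs.contMDiffAt.comp w (P.A.contMDiffAt_bret hw))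
  exact P.B.contMDiff_push.contMDiffAt.comp w h1

/-- **The level conjugation of a smooth `χ` carrying traces to traces is smooth on `A.dom`.**
[cite: GriffithsHB1964Handlebody, §§3–6] [cite: MilnorHCobordism1965, Thm. 4.1, proof of Thm. 5.4 Assertion 4 (PDF pp. 22, 29)] -/
theorem contMDiffAt_conj (hχs : ContMDiff (𝓡 n) (𝓡 n) ∞ χ) (hχ : ∀ y, χ y ∈ P.B.traces ↔ y ∈ P.A.traces)
    {x : W} (hx : x ∈ P.A.dom) : ContMDiffAt (𝓡∂ (n + 1)) (𝓡∂ (n + 1)) ∞ (P.conj χ) x := by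
  set w₁ : W := P.transportAB χ (P.A.top x) with hw₁
  have hw₁L : g w₁ = P.B.L := apply_transportAB_top χ x
  have hw₁b : w₁ ∈ P.B.basin := transportAB_top_mem_basin hχ hx
  have hℓ : g x ∈ Ioo P.B.lo P.B.hi := ⟨P.B.lo_lt_apply x, by rw [P.hi_eq]; exact hx.1⟩
  have hout : ContMDiffAt ((𝓡∂ (n + 1)).prod 𝓘(ℝ, ℝ)) (𝓡∂ (n + 1)) ∞
      (fun p : W × ℝ => P.B.θ (hittingTime P.B.θ g p.2 p.1, p.1)) (w₁, g x) :=
    P.B.slabFlow'.contMDiffAt_levelPoint_prod (by rw [hw₁L]; exact Ioo_subset_Icc_self P.B.L_mem_Ioo)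
      (P.B.not_isMCriticalPt_of_eq_L hw₁L) hℓ
      (P.B.hits_of_mem_basin_of_apply_eq_L hw₁b hw₁L (apply_mem_Ioo_B hx))
  have hin : ContMDiffAt (𝓡∂ (n + 1)) ((𝓡∂ (n + 1)).prod 𝓘(ℝ, ℝ)) ∞
      (fun z : W => (P.transportAB χ (P.A.top z), g z)) x := by
    refine ContMDiffAt.prodMk ?_ P.A.isMorseFunction.isMorse.contMDiff.contMDiffAt
    exact (contMDiffAt_transportAB hχs (P.A.depth_lt_of_apply_eq_L (BasinSetting.apply_top_of_mem_dom hx))).comp x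
      (P.A.contMDiffAt_top (BasinSetting.apply_lt_one_of_mem_dom hx) hx.2.1)
  have key : ContMDiffAt (𝓡∂ (n + 1)) (𝓡∂ (n + 1)) ∞
      ((fun p : W × ℝ => P.B.θ (hittingTime P.B.θ g p.2 p.1, p.1)) ∘
        (fun z : W => (P.transportAB χ (P.A.top z), g z))) x := hout.comp x hin
  exact key

/-! #### The cone law in the common chart ball -/

/-- **The level conjugation commutes with the scalings of the common chart ball**: for `v` in
the open ball with `ofChart v ∈ A.dom` and `0 < s ≤ 1`,
`conj χ (ofChart (s • v)) = ofChart (s • toChart (conj χ (ofChart v)))` (both flows are radial in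
the shared chart). [cite: MilnorHCobordism1965, Def. 3.1 (2), Thm. 4.1] -/
theorem conj_ofChart_smul (hχ : ∀ y, χ y ∈ P.B.traces ↔ y ∈ P.A.traces) {v : EuclideanSpace ℝ (Fin (n + 1))}
    (hv : ‖v‖ < P.A.r₀) (hxd : P.A.ofChart v ∈ P.A.dom) {s : ℝ} (hs : 0 < s) (hs1 : s ≤ 1) :
    P.conj χ (P.A.ofChart (s • v)) = P.A.ofChart (s • P.A.toChart (P.conj χ (P.A.ofChart v))) := by
  set x := P.A.ofChart v with hx
  have hxsph : g x < P.A.sph := P.A.apply_ofChart_lt_sph hv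
  have htx : P.A.toChart x = v := P.A.toChart_ofChart hv.le
  have hxs : P.A.ofChart (s • v) = P.A.θ (Real.log s, x) := by rw [← htx]; exact P.A.ofChart_smul_toChart hxsph hs hs1
  have hsv : ‖s • v‖ < P.A.r₀ := by
    rw [norm_smul, Real.norm_eq_abs, abs_of_pos hs]; exact lt_of_le_of_lt (mul_le_of_le_one_left (norm_nonneg v) hs1) hv
  have hxs_sph : g (P.A.ofChart (s • v)) < P.A.sph := P.A.apply_ofChart_lt_sph hsv
  have hxs_hi : g (P.A.ofChart (s • v)) < P.A.hi := hxs_sph.trans (P.A.sph_lt_L.trans P.A.L_lt_hi)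
  have hxsd : P.A.ofChart (s • v) ∈ P.A.dom := by
    rw [hxs] at hxs_hi ⊢; exact (P.A.θ_mem_dom_iff hxd.1 hxs_hi).2 hxd
  -- the conjugate `y` of `x`, a flow point of `w'` for `ξ_B`
  set w' := P.transportAB χ (P.A.top x) with hw'
  set y := P.conj χ x with hy
  have hw'L : g w' = P.B.L := apply_transportAB_top χ x
  have hy_eq : y = P.B.θ (hittingTime P.B.θ g (g x) w', w') := rfl
  have hyA : g y < P.A.sph := by rw [hy, apply_conj hχ hxd]; exact hxsph
  have hyB : g y < P.B.sph := by rw [P.sph_eq]; exact hyA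
  have hty : ‖P.A.toChart y‖ ^ 2 = g x - g P.A.p₀ := by rw [P.A.norm_toChart_sq hyA.le, hy, apply_conj hχ hxd]
  -- scaling `y` in the chart is flowing along `ξ_B` (same chart for `B`)
  have hys : P.A.ofChart (s • P.A.toChart y) = P.B.θ (Real.log s + hittingTime P.B.θ g (g x) w', w') := by
    rw [← P.ofChart_eq, ← P.toChart_eq, P.B.ofChart_smul_toChart hyB hs hs1, hy_eq, P.B.θ_add]
  have hlev : g (P.A.ofChart (s • P.A.toChart y)) = g (P.A.ofChart (s • v)) := by
    have h1 : ‖s • P.A.toChart y‖ ≤ P.A.r₀ := by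
      rw [norm_smul, Real.norm_eq_abs, abs_of_pos hs]
      exact (mul_le_of_le_one_left (norm_nonneg _) hs1).trans (P.A.norm_toChart_le hyA.le)
    rw [P.A.apply_ofChart h1, P.A.apply_ofChart hsv.le, norm_smul, norm_smul, mul_pow, mul_pow, hty,
      ← htx, P.A.norm_toChart_sq hxsph.le]
  have htop_s : P.A.top (P.A.ofChart (s • v)) = P.A.top x := by rw [hxs]; exact P.A.top_θ hxd.2.1 _
  rw [conj_def, htop_s, ← hw']
  rw [hys] at hlev
  have hℓ : g (P.A.ofChart (s • v)) ∈ Ioo (g P.B.p₀) P.B.hi := apply_mem_Ioo_B hxsd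
  rw [P.B.levelProj_eq_of_apply_θ_eq hw'L hℓ hlev, ← hys]

end BasinPair

end Literature.Topology.FourManifolds
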